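import Summits.QuantumFields.Balaban3D.Proofs.FibreClash
import Summits.QuantumFields.Balaban3D.Proofs.UVStability3DInputs
import Literature.MathematicalPhysics.QuantumFieldTheory.Balaban1985CMP102.SectBRestrictedLaw

/-!
# Bałaban CMP 102 (1985), d = 3 lane — `Proofs.RestrictedResiduals` (1/3): THE TRIVIAL-HISTORY INPUTS behind the RESTRICTED READINGS OF
# (41)/(47) (spine `SectBRestricted.rhoRes`, `SectBRestrictedLaw.Ineq41RestrictedAE` / `Ineq47RestrictedAE`) FOR THE LANE'S CONSTRUCTED
# TOWER — the exponent bookkeeping at `Ω_{k+1} = T_η`, the hypothesis structure `TrivStepInputs` (the booked residuals R3D-01 at the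
# trivial new history / R3D-02 + the trivial-history step leaves), its inhabitant from the (α) inputs of the END theorem, and the
# integrability of the restricted densities; the induction is `Proofs.RestrictedResidualsStd`, the (α) corollaries
# `Proofs.RestrictedResidualsAlpha`

Source: T. Bałaban, *Ultraviolet stability of three-dimensional lattice pure gauge field theories*, Commun. Math. Phys. **102** (1985)
255–275 [Balaban1985UV3] ([B10]; PDF page = journal page − 254).  (41) p. 266, (47) p. 267 L17–20, and p. 272 L32–33 «The lower bound is
proved in the same way, with all simplifications coming from the fact that Ω_{k+1} = T_η.»  Cell `ym3-torus` (HUMAN RULING D-0037, YM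
ladder rung R3), seat p1 gen 3, task P1-7 of the cell's TARGET.md §4: «a typed reduction `RunAlpha … → Ineq41Restricted W δ k` turns node
N6a's GAP-STATED into IN-TREE-MODULO-(α)».

WHAT THIS FILE PROVES / DEFINES.  `W := (stdTowerInput X K 𝔖).towerWith slot` is the lane's constructed tower (the END theorem's
`laneT 𝔠 X 𝔖 G 𝔊 S` is this at `K := (𝔠 G 𝔊).lane.carrier`, `slot := ⊤`, i.e. `Inputs.towerW`), `ε₁(k) = g_kp(g_k)` (`eps1Of`) its (4)/(7)
threshold profile — the profile at which the lane books its residuals (ruling R-FIBRE′) and at which the cell instantiates `rhoRes`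
(cell memo UV3-NODE §8.5).
* §1 `expo47_succ_le_expo57`, `expo55_triv_le_expo41_succ` — THE EXPONENT BOOKKEEPING AT THE TRIVIAL HISTORY over any `B10.TowerRun`: the
  lower / upper cluster-expansion leaves of one step (`CumulantLower` / `Cumulant58`, `Repr33_60`, `VacuumWhole`, `Decomp35_61`, `Norm35`,
  `StarCount`, `OldOutside`, `PintSucc`, `Estep62`, `RmSucc`) turn the (57)-exponent, resp. the (55)·(58)-exponent, at `Ω_{k+1} = T_η`
  into the (47)_{k+1}-exponent, resp. the (41)_{k+1}-exponent (the arithmetic of LQB's `ineq47_succ_of_leaves` / `ineq41_succ_of_leaves`,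
  isolated from the density `ρ`).
* §2 `TrivStepInputs X K 𝔖 slot j` — the inputs of ONE step at the trivial history (pieces, the two residuals, the ten leaves with their
  constants, the primitive regularity of the trivial-history data) — a hypothesis STRUCTURE; `integrable_rhoRes_std`, `rhoRes_le_rho_ae_std`
  (the integrability hypotheses of the spine's `integral_rhoRes_mul` / `setIntegral_rhoRes` / `rhoRes_le_rho_ae` DISCHARGED for the lane);
  `towerT_ae_eq_rn` (the constructed `T_j` is the RN transport a.e., ruling R-RN).
* §3 the ρ-free step leaves transport from the lane's PINNED pieces (`Inputs.pieces`, where `Proofs.Residuals` states them) to the UNPINNED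
  ones (`Inputs.piecesW`, where `Bound55Std` states the residuals) — `cumulant58_piecesW`, …, `rmSucc_piecesW`, `pintSucc_piecesW`,
  `estep62_piecesW` — and `trivStepInputs_of_alpha`: ON THE EXHIBITED FAMILY, THE (α) INPUTS `StepAlpha k` OF THE END THEOREM INHABIT
  `TrivStepInputs … k` (residuals verbatim; leaves by the lane's `stepResiduals_of_alpha`, `starCount_pieces`, `rmSucc_pieces`).
HONEST FRAMING (lane PLAN.md §0): UV stability of the d = 3 lattice theory on a finite torus, as printed, MODULO its printed inputs — NOT a
continuum limit, NOT a mass gap, NOT d = 4, nothing about the Millennium problem; the residuals, leaves and (α) rows are hypotheses; nothing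
of the paper is asserted.  No `sorry`, no new axiom.
-/

noncomputable section

namespace Summit.QuantumFields.Balaban3D.Proofs.RestrictedResiduals

open _root_.MeasureTheory
open Literature.MathematicalPhysics.QuantumFieldTheory.Balaban1983to89
open Literature.MathematicalPhysics.QuantumFieldTheory.Balaban1983to89.AveragingRT (rnTransport rnTransport_nonneg)
open Literature.MathematicalPhysics.QuantumFieldTheory.Balaban1983to89.B10SectAGathering
open Literature.MathematicalPhysics.QuantumFieldTheory.Balaban1985CMP102
open Literature.MathematicalPhysics.QuantumFieldTheory.Balaban1985CMP102.Setting
open Literature.MathematicalPhysics.QuantumFieldTheory.Balaban1985CMP102.SectB.TowerObjects (chiAll rt_mono_ae)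
open Summit.QuantumFields.Balaban3D.Carriers
open Summit.QuantumFields.Balaban3D.Proofs.Bound55Masses
open Summit.QuantumFields.Balaban3D.Proofs.Bound55Std

variable {L : ℕ}

/-! ## §1 The exponent bookkeeping at the trivial history (over any `B10.TowerRun`) -/

section Exponents

variable {T : B10.TowerRun} {k : ℕ}

/-- **(57)-exponent ⇒ (47)_{k+1}-exponent at `Ω_{k+1} = T_η`** (p. 272 L32–33; the arithmetic inside LQB's `ineq47_succ_of_leaves`, isolated
from the density): from the lower cumulant leaf, the two-sided representation / vacuum / log-Z leaves, (35), the star count, the old terms,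
`Pint_{k+1} = PoldIn + PY + PYZ`, (62) and the remainder booking, at the trivial history (where `|Z_k| = 0`),
`−(1/g²)A + Σ𝒫_{k+1} − E_{k+1} − Rm_{k+1} ≤ −(1/g²)A − E_k + (log σ₀ + d(𝔤)log g_k)|B*| + log Z + Σ𝒫_old − Rm_k + log Fl`.
Re-derived bookkeeping, no content of the paper. [cite: Balaban1985UV3, (47) p.267 + p.272 L32–33] -/
theorem expo47_succ_le_expo57 (P : StepPieces T k) {C₁' C₂ Cv C₃ C₄ C₅ c₁ C₆ : ℝ} (hk : k + 1 ≤ T.K)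
    (h58 : CumulantLower P C₁') (h60 : Repr33_60 P C₂) (hvac : VacuumWhole P Cv C₃) (h61 : Decomp35_61 P C₄)
    (h35 : Norm35 P C₅) (hstar : StarCount P c₁) (hold : OldOutside P C₆) (hPint : PintSucc P) (hE : Estep62 P)
    (hR : RmSucc P (C₁' + C₂ + C₃ + C₄)) (U : T.Cfg (k + 1)) :
    -(T.mainT (k + 1) (T.triv (k + 1)) U) + T.Pint (k + 1) (T.triv (k + 1)) U - T.Ecst (k + 1) - T.Rm (k + 1)
      ≤ -(T.mainT (k + 1) (T.triv (k + 1)) U) - T.Ecst k + (P.logσ₀ + P.dg * Real.log (T.g k)) * P.starB (T.triv (k + 1))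
        + P.logZU (T.triv (k + 1)) U + P.Pold (T.triv (k + 1)) U - T.Rm k + P.logFl (T.triv (k + 1)) U := by
  have hEcst : T.Ecst (k + 1) = T.Ecst k - T.Estep k := by
    rw [T.Ecst_eq, T.Ecst_eq, Finset.sum_eq_sum_Ico_succ_bot (by omega : k < T.K)]
    ring
  have hZ0 : P.Zvol (T.triv (k + 1)) = 0 := P.Zvol_triv
  have h58' := h58 U
  have h60' := abs_le.1 (h60 (T.triv (k + 1)) U)
  have hvac' := abs_le.1 (hvac (T.triv (k + 1)))
  have h61' := abs_le.1 (h61 (T.triv (k + 1)) U)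
  have h35' := abs_le.1 (h35 (T.triv (k + 1)))
  have hold' := abs_le.1 (hold (T.triv (k + 1)) U)
  obtain ⟨hs0, hs1⟩ := hstar (T.triv (k + 1))
  have hR' : T.Rm k + (C₁' + C₂ + C₃ + C₄) * P.rem ≤ T.Rm (k + 1) := hR
  rw [hZ0] at hvac' h35' hold' hs1
  have hstarEq : P.starB (T.triv (k + 1)) = P.starT := by
    have : P.starT - P.starB (T.triv (k + 1)) ≤ 0 := by simpa using hs1
    linarith
  rw [hPint (T.triv (k + 1)) U, hEcst, hE, hstarEq]
  nlinarith [h58', h60'.1, h60'.2, hvac'.1, hvac'.2, h61'.1, h61'.2, h35'.1, h35'.2, hold'.1, hold'.2, hR']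

/-- **(55)·(58)-exponent at `h′ = triv` ⇒ (41)_{k+1}-exponent at triv** (p. 271 L13–17 «Complementing the constants in (55) to the full
lattice …, and gathering together all the transformations and estimates, we obtain the inductive inequality (41) for k replaced by k + 1»,
read at the trivial new history, where the `Z`-terms vanish): from the upper cumulant leaf (58) and the same two-sided leaves,
`−(1/g²)A − E_k + (log σ₀ + d(𝔤)log g_k)|B*| + log Z + Σ𝒫_old + Z_k(proj triv) + Rm_k + log Fl ≤ −(1/g²)A + Σ𝒫_{k+1} − E_{k+1} + Rm_{k+1}`.
Re-derived bookkeeping, no content of the paper. [cite: Balaban1985UV3, (55) p.269 + (58) p.270 + p.271 L13–17] -/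
theorem expo55_triv_le_expo41_succ (P : StepPieces T k) {Cz C₁ C₂ Cv C₃ C₄ C₅ c₁ C₆ : ℝ} (hk : k + 1 ≤ T.K)
    (h58 : Cumulant58 P Cz C₁) (h60 : Repr33_60 P C₂) (hvac : VacuumWhole P Cv C₃) (h61 : Decomp35_61 P C₄)
    (h35 : Norm35 P C₅) (hstar : StarCount P c₁) (hold : OldOutside P C₆) (hPint : PintSucc P) (hE : Estep62 P)
    (hR : RmSucc P (C₁ + C₂ + C₃ + C₄)) (U : T.Cfg (k + 1)) :
    -(T.mainT (k + 1) (T.triv (k + 1)) U) - T.Ecst k + (P.logσ₀ + P.dg * Real.log (T.g k)) * P.starB (T.triv (k + 1))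
        + P.logZU (T.triv (k + 1)) U + P.Pold (T.triv (k + 1)) U + T.Zterm k (P.proj (T.triv (k + 1))) + T.Rm k
        + P.logFl (T.triv (k + 1)) U
      ≤ -(T.mainT (k + 1) (T.triv (k + 1)) U) + T.Pint (k + 1) (T.triv (k + 1)) U - T.Ecst (k + 1) + T.Rm (k + 1) := by
  have hEcst : T.Ecst (k + 1) = T.Ecst k - T.Estep k := by
    rw [T.Ecst_eq, T.Ecst_eq, Finset.sum_eq_sum_Ico_succ_bot (by omega : k < T.K)]
    ring
  have hZ0 : P.Zvol (T.triv (k + 1)) = 0 := P.Zvol_triv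
  have hproj : P.proj (T.triv (k + 1)) = T.triv k := P.proj_triv
  have hZt : T.Zterm k (T.triv k) = 0 := T.Zterm_triv k
  have h58' := h58 (T.triv (k + 1)) U
  have h60' := abs_le.1 (h60 (T.triv (k + 1)) U)
  have hvac' := abs_le.1 (hvac (T.triv (k + 1)))
  have h61' := abs_le.1 (h61 (T.triv (k + 1)) U)
  have h35' := abs_le.1 (h35 (T.triv (k + 1)))
  have hold' := abs_le.1 (hold (T.triv (k + 1)) U)
  obtain ⟨hs0, hs1⟩ := hstar (T.triv (k + 1))
  have hR' : T.Rm k + (C₁ + C₂ + C₃ + C₄) * P.rem ≤ T.Rm (k + 1) := hR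
  rw [hZ0] at h58' hvac' h35' hold' hs1
  have hstarEq : P.starB (T.triv (k + 1)) = P.starT := by
    have : P.starT - P.starB (T.triv (k + 1)) ≤ 0 := by simpa using hs1
    linarith
  rw [hproj, hZt, hPint (T.triv (k + 1)) U, hEcst, hE, hstarEq]
  nlinarith [h58', h60'.1, h60'.2, hvac'.1, hvac'.2, h61'.1, h61'.2, h35'.1, h35'.2, hold'.1, hold'.2, hR']

end Exponents

/-! ## §2 The trivial-history inputs of one step; integrability of the restricted densities of the constructed tower -/

section Std

variable {S : Scales L} {G : Type} [GaugeGroup G] [MeasurableSpace G] [HaarData G] [RegularGaugeGroup G]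
  {V : Type} [NormedAddCommGroup V] [NormedSpace ℂ V]
  (X : ExternalInputs S G) (K : CarrierConsts) (𝔖 : ∀ k, StepSeries S G V (nblkOf S K k) k) (slot : ℕ → Prop)

/-- **THE INPUTS OF ONE STEP `j → j+1` AT THE TRIVIAL HISTORY** for the lane's constructed tower `W = (stdTowerInput X K 𝔖).towerWith slot`:
step pieces `P` with the constants of the leaves; the lane's booked RESIDUALS R3D-01 `Fibre49` at the trivial new history («The integral
(49)» ≤ (55)·(58) with `Ω_{j+1} = T_η`) and R3D-02 `Fibre57Low` (the (57)-type lower step bound); the cluster-expansion leaves of LQB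
`B10SectAGathering` at `P` — (58) upper `Cumulant58` and lower `CumulantLower`, (33)/(60) `Repr33_60`, the whole-lattice vacuum sum
`VacuumWhole`, (35)/(61) `Decomp35_61`, (35) `Norm35`, the star count `StarCount`, p. 272 `OldOutside`, the identification `PintSucc`, (62)
`Estep62`, and the remainder booking `RmSucc` with the gathered constant; and the primitive regularity of the trivial-history data (the
minimizer map `U_j(·, triv)` of [7] measurable, the interaction sum `Σ𝒫(triv)` of (43) measurable and bounded above).  Every field is a
HYPOTHESIS of the lane's END theorem (an (α) row or a theorem from (α) rows: sibling `RestrictedResidualsAlpha.trivStepInputs_of_alpha`);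
nothing is asserted. [cite: Balaban1985UV3, (55)–(62) pp.269–272 + (47) p.267 + p.272 L32–33] -/
structure TrivStepInputs (j : ℕ) where
  /-- the step pieces of step `j → j+1` over the constructed tower -/
  P : StepPieces ((stdTowerInput X K 𝔖).towerWith slot).toTowerRun j
  /-- cumulant constant `Cz` of (58) -/
  Cz : ℝ
  /-- upper cumulant remainder constant `C₁` -/
  C₁ : ℝ
  /-- lower cumulant remainder constant `C₁'` -/
  C₁' : ℝ
  /-- representation constant `C₂` of (33)/(60) -/
  C₂ : ℝ
  /-- vacuum constant `Cv` -/
  Cv : ℝ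
  /-- vacuum remainder constant `C₃` -/
  C₃ : ℝ
  /-- log-Z decomposition constant `C₄` of (35)/(61) -/
  C₄ : ℝ
  /-- normalisation constant `C₅` of (35) -/
  C₅ : ℝ
  /-- star-count deficit constant `c₁` -/
  c₁ : ℝ
  /-- old-terms constant `C₆` of p. 272 -/
  C₆ : ℝ
  /-- RESIDUAL R3D-01 at the trivial new history -/
  fibre49_triv : Fibre49 X K 𝔖 slot j P (Hist.triv S.P (j + 1))
  /-- RESIDUAL R3D-02 -/
  fibre57Low : Fibre57Low X K 𝔖 slot j P
  /-- (58), upper -/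
  cumulant58 : Cumulant58 P Cz C₁
  /-- (58), lower direction at the trivial history -/
  cumulantLower : CumulantLower P C₁'
  /-- (33)/(60) -/
  repr33_60 : Repr33_60 P C₂
  /-- whole-lattice vacuum sum -/
  vacuumWhole : VacuumWhole P Cv C₃
  /-- (35)/(61) -/
  decomp35_61 : Decomp35_61 P C₄
  /-- (35) -/
  norm35 : Norm35 P C₅
  /-- the star count -/
  starCount : StarCount P c₁
  /-- old terms outside `Ω_{j+1}`, p. 272 -/
  oldOutside : OldOutside P C₆
  /-- `Pint (j+1) = PoldIn + PY + PYZ` -/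
  pintSucc : PintSucc P
  /-- (62) -/
  estep62 : Estep62 P
  /-- the remainder booking with the gathered constant -/
  rmSucc : RmSucc P (max C₁ C₁' + C₂ + C₃ + C₄)
  /-- `U_j(·, triv)` is measurable ([7] Thm 1 data) -/
  hU : Measurable ((stdTowerInput X K 𝔖).UkH j (Hist.triv S.P j))
  /-- `Σ𝒫(triv)` of (43) is measurable … -/
  hPm : Measurable ((stdTowerInput X K 𝔖).Pint j (Hist.triv S.P j))
  /-- … and bounded above by `cP` -/
  cP : ℝ
  /-- the upper bound of `Σ𝒫(triv)` -/
  hPb : ∀ U : GaugeField S.P j G, (stdTowerInput X K 𝔖).Pint j (Hist.triv S.P j) U ≤ cP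

omit [RegularGaugeGroup G] in
/-- The run's small-field function `χ_j` of (4) at the lane's threshold IS the spine's all-plaquette factor `χ^{ε₁(j)}` of
`SectBRestricted.chiAll` (both are `Setup.chiSmall univ (g_jp(g_j))`): definitional. [cite: Balaban1985UV3, (4) p.256 + (40) p.266] -/
theorem chiAll_eps1_eq (j : ℕ) :
    chiAll (S := S) (G := G) j (eps1Of S K j) = ((stdTowerInput X K 𝔖).towerWith slot).chi j := rfl

omit [RegularGaugeGroup G] in
/-- `χ_j ∈ {0, 1}`, hence `χ_j·χ_j = χ_j` and `0 ≤ χ_j ≤ 1` (`FibreClash.chi_eq`). [folklore] -/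
theorem chi_mul_self (j : ℕ) (U : GaugeField S.P j G) :
    ((stdTowerInput X K 𝔖).towerWith slot).chi j U * ((stdTowerInput X K 𝔖).towerWith slot).chi j U
      = ((stdTowerInput X K 𝔖).towerWith slot).chi j U := by
  rw [FibreClash.chi_eq X K 𝔖 slot j U]
  split_ifs <;> norm_num

omit [RegularGaugeGroup G] in
/-- `0 ≤ χ_j`. [folklore] -/
theorem chi_nonneg' (j : ℕ) (U : GaugeField S.P j G) : 0 ≤ ((stdTowerInput X K 𝔖).towerWith slot).chi j U := by
  rw [FibreClash.chi_eq X K 𝔖 slot j U]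
  split_ifs <;> norm_num

omit [RegularGaugeGroup G] in
/-- `χ_j ≤ 1`. [folklore] -/
theorem chi_le_one' (j : ℕ) (U : GaugeField S.P j G) : ((stdTowerInput X K 𝔖).towerWith slot).chi j U ≤ 1 := by
  rw [FibreClash.chi_eq X K 𝔖 slot j U]
  split_ifs <;> norm_num

omit [RegularGaugeGroup G] in
/-- The constructed transformation `T_j` of the tower is dV-a.e. the plain Radon–Nikodym transport over `Ū_j` (ruling R-RN: the version
selection moves null sets only; `Carriers.RTSelect.rtOpISelect_ae_eq_rn`). [folklore] -/
theorem towerT_ae_eq_rn (j : ℕ) (ρ : Density S.P j G) :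
    (((stdTowerInput X K 𝔖).towerWith slot).T j).T ρ =ᵐ[fieldMeasure S.P (j + 1) G] rnTransport (X.av j).avg ρ :=
  rtOpISelect_ae_eq_rn (X.av j) (((stdTowerInput X K 𝔖).toRunInput slot).avgAC j)
    (((stdTowerInput X K 𝔖).toRunInput slot).lower j) (((stdTowerInput X K 𝔖).toRunInput slot).upper j)
    (((stdTowerInput X K 𝔖).toRunInput slot).upper_nonneg j) ρ

/-- **THE RESTRICTED DENSITIES OF THE CONSTRUCTED TOWER ARE INTEGRABLE**, for every threshold profile `δ` (the hypothesis `hint` of the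
spine's `integral_rhoRes_mul` / `setIntegral_rhoRes` / `rhoRes_le_rho_ae`, DISCHARGED for the lane): `ρ^res_0 = χ^{δ₀}ρ₀` with `ρ₀` the
integrable Wilson start, and `ρ^res_{j+1} = χ^{δ_{j+1}}·T_j ρ^res_j` with `T_j` integrability-preserving (`integrable_rtOpISelect`) and
`χ ∈ [0,1]` measurable. [folklore] -/
theorem integrable_rhoRes_std (δ : ℕ → ℝ) :
    ∀ j, Integrable (((stdTowerInput X K 𝔖).towerWith slot).rhoRes δ j) (fieldMeasure S.P j G)
  | 0 => by
      have h0 : Integrable ((stdTowerInput X K 𝔖).towerWith slot).rho0 (fieldMeasure S.P 0 G) :=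
        integrable_wilsonStart (g0sq_nonneg S) _
      refine (h0.bdd_mul (SectB.TowerObjects.measurable_chiAll 0 (δ 0)).aestronglyMeasurable (c := 1)
        (Filter.Eventually.of_forall fun U => ?_)).congr (Filter.EventuallyEq.of_eq ?_)
      · rw [Real.norm_eq_abs]; exact SectB.TowerObjects.abs_chiAll_le_one 0 (δ 0) U
      · funext U; rfl
  | j + 1 => by
      have hT : Integrable ((((stdTowerInput X K 𝔖).towerWith slot).T j).T
          (((stdTowerInput X K 𝔖).towerWith slot).rhoRes δ j)) (fieldMeasure S.P (j + 1) G) :=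
        integrable_rtOpISelect (X.av j) (((stdTowerInput X K 𝔖).toRunInput slot).avgAC j)
          (((stdTowerInput X K 𝔖).toRunInput slot).lower j) (((stdTowerInput X K 𝔖).toRunInput slot).upper j)
          (((stdTowerInput X K 𝔖).toRunInput slot).upper_nonneg j) _ (integrable_rhoRes_std δ j)
      refine (hT.bdd_mul (SectB.TowerObjects.measurable_chiAll (j + 1) (δ (j + 1))).aestronglyMeasurable (c := 1)
        (Filter.Eventually.of_forall fun U => ?_)).congr (Filter.EventuallyEq.of_eq ?_)
      · rw [Real.norm_eq_abs]; exact SectB.TowerObjects.abs_chiAll_le_one (j + 1) (δ (j + 1)) U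
      · funext U; rfl

/-- The T-image of a restricted density is integrable (the hypothesis `hintT` of the spine's `rhoRes_le_rho_ae`, DISCHARGED). [folklore] -/
theorem integrable_T_rhoRes_std (δ : ℕ → ℝ) (j : ℕ) :
    Integrable ((((stdTowerInput X K 𝔖).towerWith slot).T j).T (((stdTowerInput X K 𝔖).towerWith slot).rhoRes δ j))
      (fieldMeasure S.P (j + 1) G) :=
  integrable_rtOpISelect (X.av j) (((stdTowerInput X K 𝔖).toRunInput slot).avgAC j)
    (((stdTowerInput X K 𝔖).toRunInput slot).lower j) (((stdTowerInput X K 𝔖).toRunInput slot).upper j)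
    (((stdTowerInput X K 𝔖).toRunInput slot).upper_nonneg j) _ (integrable_rhoRes_std X K 𝔖 slot δ j)

/-- **`ρ^res_k ≤ ρ_k` dV-a.e. FOR THE CONSTRUCTED TOWER** (the spine's `rhoRes_le_rho_ae` with all four integrability / measurability
hypotheses DISCHARGED: `ExternalInputs.av_meas`, `integrable_rhoRes_std`, `integrable_T_rhoRes_std`, `run3_rho_integrable`).
[cite: Balaban1985UV3, (47) p.267 + p.272 L32–33] -/
theorem rhoRes_le_rho_ae_std (δ : ℕ → ℝ) (k : ℕ) :
    ((stdTowerInput X K 𝔖).towerWith slot).rhoRes δ k ≤ᵐ[fieldMeasure S.P k G] ((stdTowerInput X K 𝔖).towerWith slot).rho k :=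
  ((stdTowerInput X K 𝔖).towerWith slot).rhoRes_le_rho_ae δ X.av_meas (integrable_rhoRes_std X K 𝔖 slot δ)
    (integrable_T_rhoRes_std X K 𝔖 slot δ) (run3_rho_integrable ((stdTowerInput X K 𝔖).toRunInput slot)) k

end Std

/-! ## §3 Pinned → unpinned pieces; the trivial-history inputs from the (α) inputs -/

open Summit.QuantumFields.Balaban3D.Proofs.Inputs
open Summit.QuantumFields.Balaban3D.Proofs.Residuals
open Summit.QuantumFields.Balaban3D.Proofs.Primitives
open Summit.QuantumFields.Balaban3D.Proofs.Constants (eps0Of)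
open Summit.QuantumFields.Balaban3D.Proofs.UVStability3DInputs
open Summit.QuantumFields.Balaban3D.Proofs.GroupModelLieC (lieC)

section PiecesW

variable (𝔎 : LaneConsts L) {S : Scales L} {G : Type} [GaugeGroup G] [MeasurableSpace G] [HaarData G]
  {V : Type} [NormedAddCommGroup V] [NormedSpace ℂ V]
  (X : ExternalInputs S G) (𝔖 : ∀ k, StepSeries S G V (nblkOf S 𝔎.carrier k) k) (k : ℕ)

/-! The lane states its step leaves over the PINNED tower `towerOf`/`pieces` (`Proofs.Residuals`), its fibre residuals over the UNPINNED
tower `towerW`/`piecesW` (`Proofs.Bound55Std`); pinning changes only the (41)/(47) slot, and `piecesW` has the fields of `pieces`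
(`Proofs.Inputs.piecesW`), so every ρ-free leaf transports verbatim (the ρ-leaves `Bound55`/`Bound55Lower` need `pin_rho`:
`Inputs.bound55_pieces_of_unpinned`).  Pointwise re-typing, no content. -/

/-- LQB leaf `PintSucc` for the lane's UNPINNED pieces `piecesW` — definitional for the series tower (as the lane's `pintSucc_series` for the
pinned ones): `Pint (k+1) = PoldIn + PY + PYZ`. [cite: Balaban1985UV3, (36) p.265 + (41) p.266] -/
theorem pintSucc_piecesW : PintSucc (piecesW 𝔎 X 𝔖 k) := fun _ _ => rfl

/-- LQB leaf `Estep62` ((62): `E^{(k)} = (log σ₀ + d(𝔤) log g_k)|T₁^{(k)*}| + log Z^{(k)}(T,1) + Σ_X𝒫′(1)`) for the unpinned pieces — definitional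
for the series tower (as the lane's `estep62_series`). [cite: Balaban1985UV3, (62) p.271] -/
theorem estep62_piecesW : Estep62 (piecesW 𝔎 X 𝔖 k) := rfl

variable {𝔎 X 𝔖 k}

/-- (58) `Cumulant58` transports from the pinned to the unpinned pieces (same fields, same `g_k`). [cite: Balaban1985UV3, (58) p.270] -/
theorem cumulant58_piecesW {Cz C : ℝ} (h : Cumulant58 (pieces 𝔎 X 𝔖 k) Cz C) : Cumulant58 (piecesW 𝔎 X 𝔖 k) Cz C :=
  fun h' U => h h' U

/-- `CumulantLower` transports from the pinned to the unpinned pieces. [cite: Balaban1985UV3, (37) p.265 + p.272] -/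
theorem cumulantLower_piecesW {C : ℝ} (h : CumulantLower (pieces 𝔎 X 𝔖 k) C) : CumulantLower (piecesW 𝔎 X 𝔖 k) C :=
  fun U => h U

/-- (33)/(60) `Repr33_60` transports from the pinned to the unpinned pieces. [cite: Balaban1985UV3, (33) p.264 + (60) p.271] -/
theorem repr33_60_piecesW {C : ℝ} (h : Repr33_60 (pieces 𝔎 X 𝔖 k) C) : Repr33_60 (piecesW 𝔎 X 𝔖 k) C :=
  fun h' U => h h' U

/-- `VacuumWhole` transports from the pinned to the unpinned pieces. [cite: Balaban1985UV3, p.265 + p.270] -/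
theorem vacuumWhole_piecesW {Cv C : ℝ} (h : VacuumWhole (pieces 𝔎 X 𝔖 k) Cv C) : VacuumWhole (piecesW 𝔎 X 𝔖 k) Cv C :=
  fun h' => h h'

/-- (35)/(61) `Decomp35_61` transports from the pinned to the unpinned pieces. [cite: Balaban1985UV3, (35) p.265 + (61) p.271] -/
theorem decomp35_61_piecesW {C : ℝ} (h : Decomp35_61 (pieces 𝔎 X 𝔖 k) C) : Decomp35_61 (piecesW 𝔎 X 𝔖 k) C :=
  fun h' U => h h' U

/-- (35) `Norm35` transports from the pinned to the unpinned pieces. [cite: Balaban1985UV3, (35) p.265] -/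
theorem norm35_piecesW {C : ℝ} (h : Norm35 (pieces 𝔎 X 𝔖 k) C) : Norm35 (piecesW 𝔎 X 𝔖 k) C :=
  fun h' => h h'

/-- `StarCount` transports from the pinned to the unpinned pieces. [cite: Balaban1985UV3, p.265 + p.271] -/
theorem starCount_piecesW {c₁ : ℝ} (h : StarCount (pieces 𝔎 X 𝔖 k) c₁) : StarCount (piecesW 𝔎 X 𝔖 k) c₁ :=
  fun h' => h h'

/-- `OldOutside` transports from the pinned to the unpinned pieces. [cite: Balaban1985UV3, p.272] -/
theorem oldOutside_piecesW {C : ℝ} (h : OldOutside (pieces 𝔎 X 𝔖 k) C) : OldOutside (piecesW 𝔎 X 𝔖 k) C :=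
  fun h' U => h h' U

/-- `RmSucc` transports from the pinned to the unpinned pieces (same `Rm`, same remainder unit). [cite: Balaban1985UV3, (41) p.266] -/
theorem rmSucc_piecesW {CR : ℝ} (h : RmSucc (pieces 𝔎 X 𝔖 k) CR) : RmSucc (piecesW 𝔎 X 𝔖 k) CR := by
  have h' : (towerW 𝔎 X 𝔖).Rm k + CR * (pieces 𝔎 X 𝔖 k).rem ≤ (towerW 𝔎 X 𝔖).Rm (k + 1) := h
  exact h'

end PiecesW

section Alpha

variable {S : Scales L} {G : Type} [GaugeGroup G] [MeasurableSpace G] [HaarData G] {𝔊 : GroupModel G} {𝔠 : AlphaConsts L 𝔊.N}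
  {X : ExternalInputs S G} {𝔖 : ∀ k, StepSeries S G ↥(lieC 𝔊) (nblkOf S 𝔠.lane.carrier k) k} {𝔄 : AlphaData 𝔊 𝔠 X 𝔖}
  (hS : S.ε₀ = eps0Of 𝔠.gamma0 S.g)
include hS

/-- **THE TRIVIAL-HISTORY INPUTS OF STEP `k` FROM THE (α) INPUTS OF STEP `k`** on the exhibited family: pieces `piecesW`; the residuals R3D-01
(at `h′ = triv`) / R3D-02 verbatim (`StepAlpha.fibre49` / `.fibre57Low`); the leaves C3–C8, C10 by the lane's `stepResiduals_of_alpha` (from the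
GAP binders G3D-01/02/04/05/06/07 and the displays), read over the unpinned pieces (same fields); the star count, `PintSucc`, (62) and the
remainder booking by the lane's bookkeeping theorems (`starCount_pieces`, `pintSucc_series`, `estep62_series`, `rmSucc_pieces`); the regularity
of the trivial-history data from `StepAlpha.hU/hPm/hPb`. [cite: Balaban1985UV3, (55)–(62) pp.269–272 + (47) p.267] -/
def trivStepInputs_of_alpha (k : ℕ) (hk : k + 1 ≤ S.K) (A : StepAlpha 𝔊 𝔠 X 𝔖 𝔄 k) :
    TrivStepInputs X 𝔠.lane.carrier 𝔖 (fun _ => True) k where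
  P := piecesW 𝔠.lane X 𝔖 k
  Cz := 𝔠.lane.sc.Cz
  C₁ := 𝔠.lane.sc.C₁
  C₁' := 𝔠.lane.sc.C₁'
  C₂ := 𝔠.lane.sc.C₂
  Cv := 𝔠.lane.sc.Cv
  C₃ := 𝔠.lane.sc.C₃
  C₄ := 𝔠.lane.sc.C₄
  C₅ := 𝔠.lane.sc.C₅
  c₁ := 3
  C₆ := 𝔠.lane.sc.C₆
  fibre49_triv := A.fibre49 (Hist.triv S.P (k + 1))
  fibre57Low := A.fibre57Low
  cumulant58 := cumulant58_piecesW (stepResiduals_of_alpha hS k hk A).cumulant58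
  cumulantLower := cumulantLower_piecesW (stepResiduals_of_alpha hS k hk A).cumulantLower
  repr33_60 := repr33_60_piecesW (stepResiduals_of_alpha hS k hk A).repr33_60
  vacuumWhole := vacuumWhole_piecesW (stepResiduals_of_alpha hS k hk A).vacuumWhole
  decomp35_61 := decomp35_61_piecesW (stepResiduals_of_alpha hS k hk A).decomp35_61
  norm35 := norm35_piecesW (stepResiduals_of_alpha hS k hk A).norm35
  starCount := starCount_piecesW (starCount_pieces 𝔠.lane X 𝔖 k hk)
  oldOutside := oldOutside_piecesW (stepResiduals_of_alpha hS k hk A).oldOutside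
  pintSucc := pintSucc_piecesW 𝔠.lane X 𝔖 k
  estep62 := estep62_piecesW 𝔠.lane X 𝔖 k
  rmSucc := rmSucc_piecesW (rmSucc_pieces 𝔠.lane X 𝔖 k)
  hU := A.hU (Hist.triv S.P k)
  hPm := A.hPm (Hist.triv S.P k)
  cP := 𝔄.cP k
  hPb := fun U => A.hPb (Hist.triv S.P k) U

end Alpha

end Summit.QuantumFields.Balaban3D.Proofs.RestrictedResiduals

end
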